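import Literature.AlgebraicGeometry.Resolution.Lipman1969IntersectionTheory
import HarnessLib

/-!
# Lipman 1969 Prop. (13.1) c): positivity and disjointness — PROOF of the named fact

Topic: `Literature/AlgebraicGeometry/Resolution`. PROVES the named fact `Lipman1969_13_1_c`
(`Resolution/Lipman1969IntersectionTheory.lean`, Lipman 1969 Prop. (13.1) c), p. 223, for an integral
exceptional curve `E_η`): for `D` effective avoiding `η`, `(D·E_η) ≥ 0` (the tree's
`excCurveDegree_nonneg_of_isEffective`) and `(D·E_η) = 0` iff `D` avoids every point of `closure {η}`.
Via `excCurveDegree_eq_degree_of_fac` the number is the degree of the effective restricted divisor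
`D.pullbackAvoiding E_η.ι` on the proper `κ(𝔪)`-curve `E_η`, a sum of non-negative terms
(`degree_eq_finsum`) which vanishes iff every local equation is a unit at every point
(`IsEffective.degree_pos`, `Avoids.ordAt_eq_zero`). No new definitions.

## References

* J. Lipman, *Rational singularities, with applications to algebraic surfaces and unique factorization*,
  Publ. Math. IHÉS 36 (1969) 195–279, Prop. (13.1) c) (p. 223), §12 Remark 2 c) (p. 221). [Lipman1969]
-/

noncomputable section

open CategoryTheory AlgebraicGeometry TopologicalSpace Topology IsLocalRing
open Literature.AlgebraicGeometry.Motives RatFn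

universe u

namespace Literature.AlgebraicGeometry.Resolution

/-- In the specialisation preorder of a scheme, a proper specialisation is strictly smaller. [folklore] -/
private theorem lt_of_specializes_of_ne_13_1_c {Y : Scheme.{u}} {x y : Y} (h : y ⤳ x) (hne : x ≠ y) :
    x < y :=
  ⟨Scheme.le_iff_specializes.2 h, fun h' => hne ((Scheme.le_iff_specializes.1 h').antisymm h).eq⟩

/-- **Lipman 1969, Proposition (13.1) c) (p. 223) for an integral exceptional curve.** With a factorisation
`q : E_η → Spec κ(𝔪)`, `(D·E_η) = deg_{κ(𝔪)}(D|_{E_η})` (`excCurveDegree_eq_degree_of_fac`) and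
`D|_{E_η} = pullbackAvoiding` (as `D` avoids `η`), an effective divisor on the proper integral curve `E_η`:
its degree is `Σ_v ord_v · [κ(v):κ(𝔪)]` with non-negative terms, zero iff every local equation is a unit at
every point, i.e. iff `D` avoids every point of `closure {η}` (`IsEffective.degree_pos` for the converse).
[cite: Lipman1969, Proposition (13.1) c) (p. 223)] -/
theorem Lipman1969_13_1_c_holds : Lipman1969_13_1_c.{u} := by
  intro S _ _ _ X _ _ π hπ _hreg D hD η hη hDη
  refine ⟨excCurveDegree_nonneg_of_isEffective π hη hD hDη, ?_⟩
  obtain ⟨q, hq⟩ := exists_fac_specResidueField π hη.1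
  haveI : IsIntegral (Over.mk q : SchemeOver (ResidueField S)).left :=
    inferInstanceAs (IsIntegral (ClosedSubvariety.ofPoint X η).carrier)
  haveI : IsProper (Over.mk q : SchemeOver (ResidueField S)).hom :=
    isProper_of_fac_specResidueField π hq
  have hgen : (ClosedSubvariety.ofPoint X η).ι (genericPoint (ClosedSubvariety.ofPoint X η).carrier) = η := by
    have := ClosedSubvariety.genericPoint_ofPoint (X := X) η
    unfold ClosedSubvariety.genericPoint at this
    exact this
  have hav : D.Avoids ((ClosedSubvariety.ofPoint X η).ι (genericPoint (ClosedSubvariety.ofPoint X η).carrier)) := by rw [hgen]; exact hDη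
  have hC : Order.height (⊤ : ↥(ClosedSubvariety.ofPoint X η).carrier) = 1 := height_top_ofPoint_eq_one π hη
  rw [excCurveDegree_eq_degree_of_fac π hq]
  have key : CartierDivisor.degree (Over.mk q : SchemeOver (ResidueField S))
      (D.pullbackRep (ClosedSubvariety.ofPoint X η).ι) =
      CartierDivisor.degree (Over.mk q : SchemeOver (ResidueField S))
      (D.pullbackAvoiding (ClosedSubvariety.ofPoint X η).ι hav) :=
    congrArg _ (CartierDivisor.pullbackRep_of_avoids D _ hav)
  rw [key]
  have hrange : Set.range (ClosedSubvariety.ofPoint X η).ι = closure {η} := ClosedSubvariety.range_ofPoint_ι η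
  constructor
  · intro h0 x hx
    obtain ⟨v, rfl⟩ : x ∈ Set.range (ClosedSubvariety.ofPoint X η).ι := by rw [hrange]; exact hx
    by_contra hnav
    obtain ⟨i, hi, hu⟩ : ∃ i, (ClosedSubvariety.ofPoint X η).ι v ∈ D.U i ∧ ¬ IsUnitAt ((ClosedSubvariety.ofPoint X η).ι v) (D.f i) := by
      unfold CartierDivisor.Avoids at hnav
      push Not at hnav
      exact hnav
    have hηi : (ClosedSubvariety.ofPoint X η).ι (genericPoint (ClosedSubvariety.ofPoint X η).carrier) ∈ D.U i :=
      ((genericPoint_specializes v).map (ClosedSubvariety.ofPoint X η).ι.continuous).mem_open (D.U i).2 hi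
    have hvne : v ≠ genericPoint (ClosedSubvariety.ofPoint X η).carrier := by
      intro hv
      apply hu
      rw [hv]
      exact hav i hηi
    have hlt : v < genericPoint (ClosedSubvariety.ofPoint X η).carrier :=
      lt_of_specializes_of_ne_13_1_c (genericPoint_specializes v) hvne
    have hv0 : Order.height v = 0 := by
      have h1 := Order.height_add_one_le hlt
      rw [show Order.height (genericPoint (ClosedSubvariety.ofPoint X η).carrier) = 1 from hC] at h1
      have hne : Order.height v ≠ ⊤ :=
        ne_top_of_le_ne_top (by decide) (le_trans le_self_add h1)
      have : Order.height v < 1 := (ENat.add_one_le_iff hne).1 h1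
      exact Order.lt_one_iff.1 this
    have hpos := CartierDivisor.IsEffective.degree_pos (C := Over.mk q) hC
      (hD.pullbackAvoiding (ClosedSubvariety.ofPoint X η).ι hav) (i := ⟨i, hηi⟩) (x := v) hi
      (hD.not_isUnitAt_pullbackAvoiding (ClosedSubvariety.ofPoint X η).ι hav ⟨i, hηi⟩ hi hu) hv0
    exact absurd h0 (ne_of_gt hpos)
  · intro hall
    rw [CartierDivisor.degree_eq_finsum]
    refine finsum_eq_zero_of_forall_eq_zero fun v => ?_
    have hv : (D.pullbackAvoiding (ClosedSubvariety.ofPoint X η).ι hav).Avoids v := by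
      intro i hi
      exact (hall ((ClosedSubvariety.ofPoint X η).ι v) (by rw [← hrange]; exact ⟨v, rfl⟩) i.1 hi).pullbackFn
    exact mul_eq_zero_of_left hv.ordAt_eq_zero _

end Literature.AlgebraicGeometry.Resolution

end
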